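import Literature.AlgebraicGeometry.HodgeTheory.PicardLefschetzNodalForms
import HarnessLib

/-!
# The Picard–Lefschetz fact for nodal forms KEYED TO THE CONSUMED INSTANCES: one node, and an exchanged pair of nodes

Family `hodge`, layer `Literature/AlgebraicGeometry/HodgeTheory`; sequel of `PicardLefschetzNodalForms` (typing seat `littype-FH1-2`)
and `PicardLefschetzNodalFormsFlat` (prover seat `hodge-nonav-19716-p2` g10).  Written by the prover seat `hodge-nonav-19716-p2` (g10, cell
`hodge-nonav`) for crux K1-B `VeryGeneralSignCommutatorsInHg` of the route `HodgeConjecture/SignSymmetricPowers` (stmt-HodgeConjecture-19716)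
on the route owner's DECISION (P3 g34, STATUS 2026-08-28T22:46:09Z, after prover-Bx's scoping 22:45:52Z): the Picard–Lefschetz binder of
K1-B is to be keyed to the instances its telescope consumes — «ONE node, any direction» and «an EXCHANGED PAIR of nodes, given the
exchanging symmetry» — and NOT to a statement quantifying over all numbers `k` of simultaneous nodes (`picardLefschetz_nodalForms_flat`,
`…_flatExchange`, `…_uniform` stay as the uniform facts implying these).  Two `Prop`-valued definitions (named facts), no theorem here:

* `picardLefschetz_oneNode` — for `n, d ≥ 1`, a form `f₁` of degree `d` whose hypersurface has exactly ONE ordinary double point `[p]`,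
  and `g` of degree `d` with `g(p) ≠ 0`: there is `ε₀ > 0` with (i) `f₁ + c'g` nonsingular for `0 < |c'| < ε₀`, and for every
  cohomological trivialisation datum `hU`, every `0 < ε < ε₀`, every `s'` with form `f₁ + εg` and every circle `γ` of the pencil at `s'` —
  PROVIDED, when `n` is even, that the rational transport along `γ` is not the identity (the «non-triviality rider», an explicit
  hypothesis: it is what a localisation of the monodromy to the `A₁` model needs as input in even fibre dimension, cf. the socket
  `exists_isPicardLefschetzData_one_of_pencilIsotopy` of `PicardLefschetzOfPencilIsotopy`, and what the global theory supplies) — there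
  are a class `δ ∈ Hⁿ(Y_{s'}(ℂ); ℚ)` and `c ∈ ℚ` forming Picard–Lefschetz data `IsPicardLefschetzData n d 1 … γ ![δ] c` (Voisin II
  Thm. 3.16 with Cor. 2.17, Cor. 3.17, Rem. 3.21; AGZV II §1.3).  The coefficient is PER PENCIL (no flatness clause).
* `picardLefschetz_exchangedPair` — the same for a form with exactly TWO ordinary double points `[p₀], [p₁]` EXCHANGED by a finite-order
  diagonal symmetry `a` stabilising `f₁` and `g` (`a • p₁ = t·p₀`): Picard–Lefschetz data `IsPicardLefschetzData n d 2 … γ δ c` whose two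
  vanishing cycles are exchanged up to sign by every automorphism `σ'` of the fibre acting as `[z] ↦ [a • z]`: `σ'^* δ₀ = ±δ₁` (the
  exchange rule (O) for THAT symmetry — transport of Milnor balls, vanishing cycles being defined up to sign, Voisin II Def. 2.12; no sign
  rule at fixed nodes, AGZV II §5.1 is NOT invoked).

The implications `picardLefschetz_nodalForms_flat ⟹ picardLefschetz_oneNode`, `picardLefschetz_nodalForms_flatExchange ⟹
picardLefschetz_exchangedPair` (hence `_uniform ⟹` both) and the consumer shapes «data at any radius» (odd `n`) are the theorem file
`PicardLefschetzNodalFormsKeyedShapes`.  Nothing here is proved about the geometry; nothing here says HC is proved.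

## References

* [VoisinHodgeII2003] C. Voisin, Hodge Theory and Complex Algebraic Geometry II, CUP 2003: §2.2.1 Def. 2.12, Cor. 2.17, §2.3.1,
  §3.2.1 Thm. 3.16, Cor. 3.17, Rem. 3.18, Rem. 3.21, §3.2.2.
* [ArnoldGuseinzadeVarchenko2012] V. I. Arnold, S. M. Gusein-Zade, A. N. Varchenko, Singularities of Differentiable Maps, Vol. 2:
  Part I §1.3 (Picard–Lefschetz theorem, Lemmas 1.4–1.5), §2.1 Thm. 2.1, p. 67 Corollary.
* [Lamotke1981] K. Lamotke, The topology of complex projective varieties after S. Lefschetz, §5–§6.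
-/

noncomputable section

open CategoryTheory AlgebraicGeometry MvPolynomial
open Literature.AlgebraicTopology.SingularHomology
open Literature.AlgebraicGeometry.Motives Literature.AlgebraicGeometry.Motives.UniversalHypersurface

namespace Literature.AlgebraicGeometry.HodgeTheory

section HodgeTheory

/-- **Picard–Lefschetz formula for a ONE-nodal member of the universal family of hypersurfaces, per pencil** (named fact; the
instance «`k = 1`, any direction `g`» of `picardLefschetz_nodalForms`, with the even-dimensional non-triviality rider as an explicit
hypothesis).  Let `n, d ≥ 1`, `f₁` a form of degree `d` on `ℙⁿ⁺¹_ℂ` whose hypersurface has exactly one singular point, an ordinary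
double point `[p]` (`IsNodalFormWithNodes f₁ ![p]`), and `g` a form of degree `d` with `g(p) ≠ 0`.  Then there is `ε₀ > 0` such that
(i) `f₁ + c' g` is nonsingular for `0 < |c'| < ε₀`, and for every cohomological local trivialisation datum `hU`, every `0 < ε < ε₀`,
every point `s'` of `U(ℂ)` with form `f₁ + ε g` and every loop `γ` at `s'` running once around the circle `f₁ + ε e^{2πiθ} g` — and, IF
`n` IS EVEN, provided the rational transport of `Rⁿπ_*ℚ` along `γ` is not the identity — there are `δ ∈ Hⁿ(Y_{s'}(ℂ); ℚ)` and `c ∈ ℚ`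
forming Picard–Lefschetz data for `γ` (`IsPicardLefschetzData n d 1 … γ ![δ] c`: `c ≠ 0`; monodromy `x ↦ x + c B(x, δ) δ` in degree
`n`, trivial in the other degrees; `c B(δ, δ) = -2`, `δ ≠ 0` for even `n`; `B(δ, δ) = 0` for odd `n`).
[cite: VoisinHodgeII2003, §3.2.1 Thm. 3.16, Cor. 3.17, Rem. 3.18, Rem. 3.21 and §2.2.2 Cor. 2.17 (held text chunks p0094–p0099)]
[cite: ArnoldGuseinzadeVarchenko2012, Part I §1.3 Picard–Lefschetz theorem with Lemmas 1.4, 1.5 (held text chunks p0022–p0026)]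
[cite: Lamotke1981, §6 (the Picard–Lefschetz formulas)] -/
def picardLefschetz_oneNode : Prop :=
  ∀ (n d : ℕ) (hn : 1 ≤ n) (hd : 1 ≤ d) (f₁ g : MvPolynomial (Fin (n + 2)) ℂ),
    f₁.IsHomogeneous d → g.IsHomogeneous d →
    ∀ (p : Fin (n + 2) → ℂ), IsNodalFormWithNodes f₁ ![p] → eval p g ≠ 0 →
      ∃ ε₀ : ℝ, 0 < ε₀ ∧
        (∀ c' : ℂ, c' ≠ 0 → ‖c'‖ < ε₀ → SmoothHypersurface.IsNonsingularForm ℂ (f₁ + c' • g)) ∧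
        ∀ (hU : IsCohomologicallyLocallyTrivialOn (family ℂ n d) Set.univ) (ε : ℝ), 0 < ε → ε < ε₀ →
          ∀ (s' : ComplexPoints (base ℂ n d)), pointForm ℂ n d s' = f₁ + (ε : ℂ) • g →
            ∀ (γ : Path s' s'), IsPencilCircle n d f₁ g ε γ →
              (Even n → ∀ T : bettiCohomology (fiberOver (family ℂ n d) s') n ≃ₗ[ℚ]
                  bettiCohomology (fiberOver (family ℂ n d) s') n,
                IsRatTransport (family ℂ n d) n hU (loopClassUniv n d γ) T → T ≠ LinearEquiv.refl ℚ _) →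
              ∃ (δ : bettiCohomology (fiberOver (family ℂ n d) s') n) (c : ℚ),
                IsPicardLefschetzData n d 1 hn hd hU γ ![δ] c

/-- **Picard–Lefschetz formula for a TWO-nodal member whose nodes are exchanged by a diagonal symmetry of the pencil, per pencil, with the
exchange rule for that symmetry** (named fact; the instance «`k = 2`, exchanged pair» of `picardLefschetz_nodalForms_flatExchange` without
the flatness clause).  Let `n, d ≥ 1`, `f₁` a form of degree `d` whose hypersurface has exactly the two ordinary double points `[p₀], [p₁]`
(`IsNodalFormWithNodes f₁ p`, `p : Fin 2 → ℂⁿ⁺²`), `g` a form of degree `d` with `g(pᵢ) ≠ 0`, and `a ∈ (ℂˣ)ⁿ⁺²` a diagonal of finite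
order stabilising `f₁` and `g` with `a • p₁ = t p₀` (the symmetry exchanges the two nodes).  Then there is `ε₀ > 0` such that (i)
`f₁ + c' g` is nonsingular for `0 < |c'| < ε₀`, and for every `hU`, every `0 < ε < ε₀`, every `s'` with form `f₁ + ε g` and every circle
`γ` of the pencil at `s'` — provided, if `n` is even, that the rational transport along `γ` is not the identity — there are classes
`δ₀, δ₁ ∈ Hⁿ(Y_{s'}(ℂ); ℚ)` and `c ∈ ℚ` forming Picard–Lefschetz data for `γ` (`IsPicardLefschetzData n d 2 … γ δ c`: orthogonal vanishing
cycles, monodromy `x ↦ x + c Σᵢ B(x, δᵢ) δᵢ`, parities) such that every automorphism `σ'` of `Y_{s'}` over `ℂ` acting as `[z] ↦ [a • z]` on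
homogeneous coordinates satisfies `σ'^* δ₀ = δ₁` or `σ'^* δ₀ = -δ₁` (the symmetry carries a Milnor ball at `p₁` to one at `p₀`, and
vanishing cycles are defined up to sign).
[cite: VoisinHodgeII2003, §3.2.1 Thm. 3.16, Cor. 3.17, Rem. 3.21 and §2.2.1 Def. 2.12 (vanishing cycles are defined up to sign)]
[cite: ArnoldGuseinzadeVarchenko2012, Part I §1.3, §2.1 Thm. 2.1 and p. 67 Corollary (orthogonality of the cycles of distinct critical points)]
[cite: Lamotke1981, §6 (the Picard–Lefschetz formulas)] -/
def picardLefschetz_exchangedPair : Prop :=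
  ∀ (n d : ℕ) (hn : 1 ≤ n) (hd : 1 ≤ d) (f₁ g : MvPolynomial (Fin (n + 2)) ℂ),
    f₁.IsHomogeneous d → g.IsHomogeneous d →
    ∀ (p : Fin 2 → Fin (n + 2) → ℂ), IsNodalFormWithNodes f₁ p → (∀ i, eval (p i) g ≠ 0) →
      ∀ (a : Fin (n + 2) → ℂˣ), IsOfFinOrder a → a ∈ diagonalStabilizer f₁ → a ∈ diagonalStabilizer g →
        (∃ t : ℂ, a • p 1 = t • p 0) →
        ∃ ε₀ : ℝ, 0 < ε₀ ∧
          (∀ c' : ℂ, c' ≠ 0 → ‖c'‖ < ε₀ → SmoothHypersurface.IsNonsingularForm ℂ (f₁ + c' • g)) ∧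
          ∀ (hU : IsCohomologicallyLocallyTrivialOn (family ℂ n d) Set.univ) (ε : ℝ), 0 < ε → ε < ε₀ →
            ∀ (s' : ComplexPoints (base ℂ n d)), pointForm ℂ n d s' = f₁ + (ε : ℂ) • g →
              ∀ (γ : Path s' s'), IsPencilCircle n d f₁ g ε γ →
                (Even n → ∀ T : bettiCohomology (fiberOver (family ℂ n d) s') n ≃ₗ[ℚ]
                    bettiCohomology (fiberOver (family ℂ n d) s') n,
                  IsRatTransport (family ℂ n d) n hU (loopClassUniv n d γ) T → T ≠ LinearEquiv.refl ℚ _) →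
                ∃ (δ : Fin 2 → bettiCohomology (fiberOver (family ℂ n d) s') n) (c : ℚ),
                  IsPicardLefschetzData n d 2 hn hd hU γ δ c ∧
                    ∀ (σ' : fiberOver (family ℂ n d) s' ⟶ fiberOver (family ℂ n d) s'),
                      (∀ x : ComplexPoints (fiberOver (family ℂ n d) s'),
                          fibrePoint n d s' (AlgPoints.map σ' x) =
                            Projectivization.mk ℂ (a • (fibrePoint n d s' x).rep)
                              ((smul_ne_zero_iff_ne a).mpr (Projectivization.rep_nonzero _))) →
                      BettiUniverse.pull σ' n (δ 0) = δ 1 ∨ BettiUniverse.pull σ' n (δ 0) = -δ 1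

end HodgeTheory

end Literature.AlgebraicGeometry.HodgeTheory

end
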